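import Mathlib
import HarnessLib
import Summits.NavierStokesRegularity.NavierStokesRegularity.Theorems.AxisTwistDoorAveragedConeLiouvillePositivityAffine
import Summits.NavierStokesRegularity.NavierStokesRegularity.Theorems.AxisTwistDoorAveragedConeLiouvillePositivityFactC
import Summits.NavierStokesRegularity.NavierStokesRegularity.Theorems.AxisTwistDoorAveragedConeLiouvilleHarnackChainCore

/-!
# Route `HalfSpaceWindowDoor`, crux `CirculationCarryingRigidity` (stmt-NavierStokesRegularity-25311) — brick 1 of the one-sided
# eddy-torque engine: a MEASURE-THEORETIC lower bound propagates along a chain of parabolic cylinders (unconditional)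

Line `eddy_torque` (LEAD ns-hsw-p1 g4).  The recommended next engine (crux card `Lines/eddy_torque.md`, memo EDDY-TORQUE-g4.md)
replaces KNSS's Lemma 2.1 — pointwise propagation of near-maximality for SOLUTIONS, the only obstruction to the ONE-SIDED
census theorem «eddy spin-up slaved to the mean vertical vorticity ⇒ poloidal» — by positivity propagation for the
SUPERsolution `V = M − F` (brick 0, `…EddyTorqueOneSided`: the one-sided eddy bound makes `F` a subsolution with a divergence-free
drift).  This file supplies the propagation mechanism, entirely from landed AxisTwistDoor bricks:
`positivityPropagationAffineC_holds` (the classical positivity propagation on arbitrary parabolic cylinders —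
`…PositivityFactC.positivityPropagationFactC_holds` + `…PositivityAffine`) and `…HarnackChainCore.chain_positivity`.

`propagation_from_measure_along_chain`: for `T > 0`, `Λ ≥ 0`, `δ > 0` there are `β₁ > 0`, `β₀ ∈ (0,1]` such that a classical
supersolution `V ≥ 0` of `∂ₜV − ΔV + b·∇V ≥ 0` (`b ∈ C¹`, divergence-free, `|b| ≤ Λ/ρ` resp. `Λ/(ρ/2)`) whose superlevel set
`{V(t̄,·) ≥ λ}` has measure `≥ δρ³` in `B(x₀,ρ)` at an early time of an initial cylinder satisfies `V ≥ β₁β₀^{k+1}λ` on the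
later halves of a chain of cylinders of radius `ρ/2` (centres at consecutive distance `≤ ρ/4`) issued from it.  Read
contrapositively for `V = M − u`: a subsolution `u ≤ M` that is `≥ M − η` at the END of the chain (a near-maximum point) has,
at the early time `t̄`, `|{u(t̄,·) ≤ M − λ} ∩ B(x₀,ρ)| < δρ³` whenever `η < β₁β₀^{N+1}λ` — KNSS's plateau (5.14) IN MEASURE,
which is all the integral estimates (5.15)–(5.20) need (`|F| ≤ D` on the exceptional set).  What remains for the engine:
the chain geometry in the rescaled annular box `{1 ≤ r ≤ 2, |z| ≤ L} × (1, T)` (vertical segment + radial segment + arc, all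
at distance `≥ 3/4` from the axis) with a uniform bound on `N`, and the estimates re-run with the exceptional set.

Seat ns-hsw-p1 g4 (LEAD of 25311, cell pub-ns-dss).  WHAT THIS IS NOT: not a statement about Navier–Stokes regularity
(Clay A): a parabolic bookkeeping lemma; no Liouville theorem is proved in this file; helper `--supports` 25311.
-/

noncomputable section

-- the summit and its single sub-problem share the name (CONVENTIONS §1), as in every Theorems file
set_option linter.dupNamespace false

namespace Summit.NavierStokesRegularity.NavierStokesRegularity.Theorems.HalfSpaceWindowDoorCirculationCarryingRigidityEddyTorqueMeasurePlateau

open MeasureTheory Set Function Filter Topology TopologicalSpace InnerProductSpace Metric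
open scoped Laplacian RealInnerProductSpace ENNReal
open Literature.Analysis Literature.Analysis.FluidPDE
open Summit.NavierStokesRegularity.NavierStokesRegularity.Theorems.AxisTwistDoorAveragedConeLiouvilleDefs (PositivityPropagationFactC)
open Summit.NavierStokesRegularity.NavierStokesRegularity.Theorems.AxisTwistDoorAveragedConeLiouvillePositivityAffine
  (PositivityPropagationAffineC positivityPropagationAffine_of_factC)
open Summit.NavierStokesRegularity.NavierStokesRegularity.Theorems.AveragedConeLiouville.PositivityFactC
  (positivityPropagationFactC_holds)
open Summit.NavierStokesRegularity.NavierStokesRegularity.Theorems.AveragedConeLiouville.HarnackChainCore (chain_positivity)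

/-- The affine positivity propagation holds unconditionally (tree: `positivityPropagationFactC_holds` + affine covariance). -/
theorem positivityPropagationAffineC_holds : PositivityPropagationAffineC :=
  positivityPropagationAffine_of_factC positivityPropagationFactC_holds

/-- **PROPAGATION OF A MEASURE-THEORETIC LOWER BOUND ALONG A CHAIN OF CYLINDERS** (unconditional).  For a time shape
`T > 0`, a drift constant `Λ ≥ 0` and a density `δ > 0` there are `β₁ > 0` and `β₀ ∈ (0,1]` such that: for every classical
supersolution `V ≥ 0` of `∂ₜV − ΔV + b·∇V ≥ 0` with a `C¹` divergence-free drift, `|b| ≤ Λ/ρ` on an initial cylinder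
`[t_I, t_I + ρ²T] × B̄(x₀, ρ)` and `|b| ≤ Λ/(ρ/2)` on a chain of cylinders of radius `ρ/2` with centres `x₀, x₁, …, x_N`
(consecutive distance `≤ ρ/4`) and start times `t_I + ρ²T/2 + k·(ρ/2)²T/2`, all inside the open set where `V ∈ C²`,
`b ∈ C¹`: if at some time `t̄ ∈ (t_I, t_I + ρ²T/3)` the superlevel set `{V(t̄,·) ≥ λ}` occupies measure `≥ δρ³` of `B(x₀,ρ)`,
then `V ≥ β₁ β₀^{k+1} λ` on the later half of the `k`-th chain cylinder, on `B(x_k, ρ/4)`.  (One application of the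
measure-entry positivity propagation, then AxisTwistDoor's `chain_positivity`.)  Contrapositive use (the one-sided
eddy-torque engine): a SUBSOLUTION `u ≤ M` which is `≥ M − η` at the end of the chain has `{u(t̄,·) ≤ M − λ}` of measure
`< δρ³` in the initial ball, as soon as `η < β₁β₀^{N+1}λ`. -/
theorem propagation_from_measure_along_chain {T Λ δ : ℝ} (hT : 0 < T) (hΛ : 0 ≤ Λ) (hδ : 0 < δ) :
    ∃ β₁ β₀ : ℝ, 0 < β₁ ∧ 0 < β₀ ∧ β₀ ≤ 1 ∧
      ∀ (V : ℝ → EuclideanSpace ℝ (Fin 3) → ℝ) (b : ℝ → EuclideanSpace ℝ (Fin 3) → EuclideanSpace ℝ (Fin 3))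
        (U : Set (ℝ × EuclideanSpace ℝ (Fin 3))) (x : ℕ → EuclideanSpace ℝ (Fin 3)) (tI ρ lam tbar : ℝ) (N : ℕ),
        0 < ρ → 0 < lam → IsOpen U → ContDiffOn ℝ 2 (Function.uncurry V) U → ContDiffOn ℝ 1 (Function.uncurry b) U →
        -- the initial cylinder and its data
        Set.Icc tI (tI + ρ ^ 2 * T) ×ˢ Metric.closedBall (x 0) ρ ⊆ U →
        (∀ t ∈ Set.Ioo tI (tI + ρ ^ 2 * T), ∀ y ∈ Metric.ball (x 0) ρ,
          ‖b t y‖ ≤ Λ / ρ ∧ VectorCalculus.divergence (b t) y = 0 ∧ 0 ≤ V t y ∧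
            0 ≤ deriv (fun τ => V τ y) t - (Δ (V t)) y + ⟪b t y, gradient (V t) y⟫_ℝ) →
        tI < tbar → tbar < tI + ρ ^ 2 * T / 3 →
        ENNReal.ofReal (δ * ρ ^ 3) ≤ volume {y : EuclideanSpace ℝ (Fin 3) | y ∈ Metric.ball (x 0) ρ ∧ lam ≤ V tbar y} →
        -- the chain of radius `ρ/2` starting at time `t_I + ρ²T/2`
        (∀ k : ℕ, k < N → dist (x (k + 1)) (x k) ≤ (ρ / 2) / 2) →
        (∀ k : ℕ, k ≤ N →
          Set.Icc (tI + ρ ^ 2 * T / 2 + k * ((ρ / 2) ^ 2 * T / 2))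
              (tI + ρ ^ 2 * T / 2 + k * ((ρ / 2) ^ 2 * T / 2) + (ρ / 2) ^ 2 * T) ×ˢ Metric.closedBall (x k) (ρ / 2) ⊆ U) →
        (∀ k : ℕ, k ≤ N → ∀ t ∈ Set.Ioo (tI + ρ ^ 2 * T / 2 + k * ((ρ / 2) ^ 2 * T / 2))
            (tI + ρ ^ 2 * T / 2 + k * ((ρ / 2) ^ 2 * T / 2) + (ρ / 2) ^ 2 * T), ∀ y ∈ Metric.ball (x k) (ρ / 2),
          ‖b t y‖ ≤ Λ / (ρ / 2) ∧ VectorCalculus.divergence (b t) y = 0 ∧ 0 ≤ V t y ∧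
            0 ≤ deriv (fun τ => V τ y) t - (Δ (V t)) y + ⟪b t y, gradient (V t) y⟫_ℝ) →
        ∀ k : ℕ, k ≤ N →
          ∀ t ∈ Set.Ioo (tI + ρ ^ 2 * T / 2 + k * ((ρ / 2) ^ 2 * T / 2) + (ρ / 2) ^ 2 * T / 2)
              (tI + ρ ^ 2 * T / 2 + k * ((ρ / 2) ^ 2 * T / 2) + (ρ / 2) ^ 2 * T),
            ∀ y ∈ Metric.ball (x k) ((ρ / 2) / 2), β₁ * β₀ ^ (k + 1) * lam ≤ V t y := by
  have hAff : PositivityPropagationAffineC := positivityPropagationAffineC_holds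
  -- the single-cylinder step (measure entry, conclusion on the half ball)
  obtain ⟨β₁, hβ₁, H1⟩ := hAff δ T (1 / 2) Λ hδ hT (by norm_num) (by norm_num) hΛ
  -- the chain
  obtain ⟨β₀, hβ₀, hβ₀1, Hc⟩ := chain_positivity hAff hT hΛ
  refine ⟨β₁, β₀, hβ₁, hβ₀, hβ₀1, ?_⟩
  intro V b U x tI ρ lam tbar N hρ hlam hU hV hb hsub0 hdata0 ht1 ht2 hmeas hdist hsubU hdata k hk t ht y hy
  have hρ2 : 0 < ρ / 2 := by positivity
  -- step 1: `V ≥ β₁ λ` on `(t_I + ρ²T/2, t_I + ρ²T) × B(x₀, ρ/2)`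
  have step1 : ∀ t' ∈ Set.Ioo (tI + ρ ^ 2 * T / 2) (tI + ρ ^ 2 * T), ∀ y' ∈ Metric.ball (x 0) (1 / 2 * ρ),
      β₁ * lam ≤ V t' y' :=
    H1 V b U (x 0) tI ρ hρ hU hsub0 hV hb (fun t ht y hy => (hdata0 t ht y hy).1) (fun t ht y hy => (hdata0 t ht y hy).2.1)
      (fun t ht y hy => (hdata0 t ht y hy).2.2.1) (fun t ht y hy => (hdata0 t ht y hy).2.2.2) tbar lam ht1 ht2 hlam hmeas
  -- step 2: the chain with radius `ρ/2`, entry at time `t₀' + (ρ/2)²T/4 = t_I + 9ρ²T/16`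
  have hentry : ∀ y' ∈ Metric.ball (x 0) (ρ / 2), β₁ * lam ≤ V (tI + ρ ^ 2 * T / 2 + (ρ / 2) ^ 2 * T / 4) y' := by
    intro y' hy'
    have hρT : 0 < ρ ^ 2 * T := by positivity
    refine step1 _ ⟨by nlinarith, by nlinarith⟩ y' (by rwa [show 1 / 2 * ρ = ρ / 2 by ring])
  have h := Hc V b U x (tI + ρ ^ 2 * T / 2) (ρ / 2) (β₁ * lam) N hρ2 (by positivity) hU hV hb hdist hsubU hdata hentry
    k hk t ht y hy
  calc β₁ * β₀ ^ (k + 1) * lam = β₀ ^ (k + 1) * (β₁ * lam) := by ring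
    _ ≤ V t y := h

end Summit.NavierStokesRegularity.NavierStokesRegularity.Theorems.HalfSpaceWindowDoorCirculationCarryingRigidityEddyTorqueMeasurePlateau

end
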